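import Literature.Computability.AlgebraicComplexity.SymmetricArithCircuit
import Mathlib.Data.Fintype.Card
import Mathlib.Data.Fintype.Sum
import Mathlib.Data.Set.Finite.Range
import Mathlib.Logic.Equiv.Sum
import HarnessLib

/-!
# Symmetric circuits: invariant constant families

Topic `Computability/AlgebraicComplexity`, namespace `Literature.Computability.AlgebraicComplexity`.

A closure property of Dawar–Wilsenach symmetric arithmetic circuits
(`SymmetricArithCircuit.lean`: `LabelledArithCircuit` = Def. 2.2, `IsAutomorphismExtending` =
Def. 3.6, `IsSymmetric` = Def. 3.7 of A. Dawar, G. Wilsenach, *Symmetric Arithmetic Circuits*,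
Theory of Computing 21 (2025)): for any group `Γ` acting on the variables `X` and on a finite
index set `Y`, a `Γ`-INVARIANT family of constants `c : Y → K` (`c (γ • y) = c y`; e.g. the
identity matrix `(δ_ij)_{ij}`, the all-ones matrix, a constant diagonal matrix, for `S_n` acting
diagonally on `[n] × [n]`) is computed — as the family of constant polynomials
`(C (c y))_{y ∈ Y}` at outputs indexed by `Y` — by a `Γ`-symmetric labelled circuit over `K` and
`X` with at most `2 |Y|` gates and no variable gate (`LabelledArithCircuit.exists_constOutputs`).
Together with pairing, Hadamard products and linear combinations of output families
(`SymmetricCircuitPairing.lean`, `SymmetricCircuitHadamard.lean`, `SymmetricCircuitLinComb.lean`)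
this lets constant equivariant matrices enter symmetric computations (Dawar–Wilsenach, remark
after Def. 3.7: symmetric circuits compute symmetric polynomials, and conversely the elementary
closure properties).

Construction (`LabelledArithCircuit.ConstOutputs.constOutputsCircuit X c`): gate set
`↥(Set.range c) ⊕ Y`; the gate `Sum.inl v`, one for each VALUE `v` of `c`, is the input gate
labelled by the constant `v`, so that distinct input gates have distinct labels as Def. 2.2
demands (this is why the values, not the indices, carry the constant gates); the gate `Sum.inr y`
is a unary addition gate whose single child is the constant gate `constSrc c y = Sum.inl ⟨c y, _⟩`
and it is the output gate indexed `y` (outputs are injectively indexed, Anderson–Dawar Def. 4).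
Semantics (`constOutputsCircuit_eval_output`): the output `y` computes `C (c y)`
(`eval_of_label_add`, `Finset.sum_singleton`, `eval_of_label_const`). Symmetry
(`constOutputsCircuit_isAutomorphismExtending`): `γ ∈ Γ` extends as `id ⊕ (γ • ·)`
(`Equiv.sumCongr`): the child of `Sum.inr (γ • y)` is `constSrc c (γ • y) = constSrc c y` by the
invariance of `c` (`constSrc_smul`), and the constant gates with their labels `const v` and the
label `+` are fixed, as Def. 3.6 demands. Size: `|Set.range c| + |Y| ≤ 2 |Y|`
(`Fintype.card_sum`, `Fintype.card_range_le`).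
Everything is folklore and proved; nothing here is a named fact.
-/

noncomputable section

open scoped Classical

namespace Literature.Computability.AlgebraicComplexity

open MvPolynomial

universe u v w z

namespace LabelledArithCircuit

namespace ConstOutputs

variable {K : Type u} (X : Type v) {Y : Type z} (c : Y → K)

/-! ### The construction -/

/-- The constant gate carrying the value `c y`, in the gate set `↥(Set.range c) ⊕ Y` (one
constant gate per value of `c`). [cite: DawarWilsenach2025, Def. 2.2] -/
def constSrc (y : Y) : ↥(Set.range c) ⊕ Y :=
  Sum.inl ⟨c y, Set.mem_range_self y⟩

/-- Wires of the constant-family circuit: a constant gate `Sum.inl v` has no children, the copy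
gate `Sum.inr y` has the single child `constSrc c y`. [cite: DawarWilsenach2025, Def. 2.2] -/
def constWires : ↥(Set.range c) ⊕ Y → Finset (↥(Set.range c) ⊕ Y)
  | .inl _ => ∅
  | .inr y => {constSrc c y}

/-- Labels of the constant-family circuit: `Sum.inl v` is the input gate labelled by the constant
`v`, `Sum.inr y` is an addition gate (a unary copy of `constSrc c y`).
[cite: DawarWilsenach2025, Def. 2.2] -/
def constLabel : ↥(Set.range c) ⊕ Y → CircuitLabel K X
  | .inl v => .const v.1
  | .inr _ => .add

variable {X c}

/-! #### Acyclicity -/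

/-- Constant gates are accessible for the child relation (they have no children).
[cite: DawarWilsenach2025, Def. 2.2] -/
theorem acc_constWires_inl (v : ↥(Set.range c)) :
    Acc (fun s t : ↥(Set.range c) ⊕ Y => s ∈ constWires c t) (.inl v) :=
  Acc.intro _ fun s hs => absurd hs (Finset.notMem_empty s)

/-- Copy gates are accessible for the child relation (their child is a constant gate).
[cite: DawarWilsenach2025, Def. 2.2] -/
theorem acc_constWires_inr (y : Y) :
    Acc (fun s t : ↥(Set.range c) ⊕ Y => s ∈ constWires c t) (.inr y) := by
  refine Acc.intro _ fun s hs => ?_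
  have hs' : s = constSrc c y := Finset.mem_singleton.mp hs
  rw [hs']
  exact acc_constWires_inl _

/-- The child relation of the constant-family circuit is well founded (the circuit has depth one).
[cite: DawarWilsenach2025, Def. 2.2] -/
theorem constWires_wf : WellFounded fun s t : ↥(Set.range c) ⊕ Y => s ∈ constWires c t :=
  ⟨fun s => match s with
    | .inl v => acc_constWires_inl v
    | .inr y => acc_constWires_inr y⟩

/-! #### The labelled circuit -/

/-- Input labels exactly at the gates without children: the constant gates.
[cite: DawarWilsenach2025, Def. 2.2] -/
theorem isInput_constLabel_iff (s : ↥(Set.range c) ⊕ Y) :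
    (constLabel X c s).IsInput ↔ constWires c s = ∅ := by
  cases s with
  | inl v => exact iff_of_true trivial rfl
  | inr y => exact iff_of_false CircuitLabel.not_isInput_add (Finset.singleton_ne_empty _)

/-- Distinct input gates have distinct labels: the constant gate `Sum.inl v` is the only gate
labelled `const v`. [cite: DawarWilsenach2025, Def. 2.2] -/
theorem eq_of_constLabel_eq (s t : ↥(Set.range c) ⊕ Y) (hs : (constLabel X c s).IsInput)
    (hst : constLabel X c s = constLabel X c t) : s = t := by
  cases s with
  | inl v =>
    cases t with
    | inl v' => exact congrArg Sum.inl (Subtype.ext (CircuitLabel.const.inj hst))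
    | inr y => exact absurd hst (by simp [constLabel])
  | inr y => exact absurd hs CircuitLabel.not_isInput_add

variable (X c)

/-- **The constant-family circuit** of `c : Y → K` over the variables `X` (module docstring): one
constant gate `Sum.inl v` per value `v` of `c`, and for each index `y` a unary addition gate
`Sum.inr y` over the constant gate with value `c y`, which is the output gate indexed `y`.
[cite: DawarWilsenach2025, Def. 2.2] -/
def constOutputsCircuit : LabelledArithCircuit K X Y (↥(Set.range c) ⊕ Y) where
  children := constWires c
  label := constLabel X c
  output := Sum.inr
  wf := constWires_wf
  isInput_iff := isInput_constLabel_iff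
  eq_of_label_eq := eq_of_constLabel_eq
  output_injective := Sum.inr_injective

variable {X c}

/-! ### Semantics -/

section Eval

variable [CommSemiring K]

/-- A constant gate evaluates to its constant. [cite: DawarWilsenach2025, §3.3] -/
theorem constOutputsCircuit_eval_inl (v : ↥(Set.range c)) :
    (constOutputsCircuit X c).eval (.inl v) = MvPolynomial.C v.1 :=
  (constOutputsCircuit X c).eval_of_label_const rfl

/-- The copy gate `Sum.inr y` evaluates to the constant polynomial `C (c y)` (a unary sum).
[cite: DawarWilsenach2025, §2 (evaluation)] -/
theorem constOutputsCircuit_eval_inr (y : Y) :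
    (constOutputsCircuit X c).eval (.inr y) = MvPolynomial.C (c y) := by
  rw [(constOutputsCircuit X c).eval_of_label_add
    (show (constOutputsCircuit X c).label (.inr y) = .add from rfl)]
  change ∑ h ∈ ({constSrc c y} : Finset (↥(Set.range c) ⊕ Y)),
    (constOutputsCircuit X c).eval h = _
  rw [Finset.sum_singleton]
  exact constOutputsCircuit_eval_inl _

/-- **Semantics.** The output indexed `y` computes the constant polynomial `C (c y)`.
[cite: DawarWilsenach2025, §2 (evaluation)] -/
theorem constOutputsCircuit_eval_output (y : Y) :
    (constOutputsCircuit X c).eval ((constOutputsCircuit X c).output y) =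
      MvPolynomial.C (c y) :=
  constOutputsCircuit_eval_inr y

end Eval

/-! ### Symmetry -/

section Symmetry

variable {Γ : Type*} [Group Γ] [MulAction Γ X] [MulAction Γ Y]

/-- For a `Γ`-invariant family `c`, the constant gate of `γ • y` is that of `y`.
[cite: DawarWilsenach2025, Def. 3.6] -/
theorem constSrc_smul (hc : ∀ (γ : Γ) (y : Y), c (γ • y) = c y) (γ : Γ) (y : Y) :
    constSrc c (γ • y) = constSrc c y :=
  congrArg Sum.inl (Subtype.ext (hc γ y))

/-- **Symmetry.** For a `Γ`-invariant family `c`, every `γ ∈ Γ` extends to the automorphism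
`id ⊕ (γ • ·)` of the constant-family circuit: constant gates (and their labels) are fixed, the
copy gate `y` goes to the copy gate `γ • y`, whose child `constSrc c (γ • y) = constSrc c y` is the
(fixed) image of the child of `y`, and the label `+` is fixed. [cite: DawarWilsenach2025, Def. 3.6] -/
theorem constOutputsCircuit_isAutomorphismExtending (hc : ∀ (γ : Γ) (y : Y), c (γ • y) = c y)
    (γ : Γ) :
    (constOutputsCircuit X c).IsAutomorphismExtending γ
      (Equiv.sumCongr (Equiv.refl ↥(Set.range c)) (MulAction.toPerm γ)) := by
  refine ⟨?_, ?_, fun _ => rfl⟩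
  · rintro (v | y)
    · exact (Finset.map_empty _).symm
    · change ({constSrc c (γ • y)} : Finset (↥(Set.range c) ⊕ Y)) =
        ({constSrc c y} : Finset (↥(Set.range c) ⊕ Y)).map
          (Equiv.sumCongr (Equiv.refl ↥(Set.range c)) (MulAction.toPerm γ)).toEmbedding
      rw [Finset.map_singleton, constSrc_smul hc]
      rfl
  · rintro (v | y)
    · rfl
    · rfl

/-- For a `Γ`-invariant family `c`, the constant-family circuit is `Γ`-symmetric (Def. 3.7).
[cite: DawarWilsenach2025, Def. 3.7] -/
theorem constOutputsCircuit_isSymmetric (hc : ∀ (γ : Γ) (y : Y), c (γ • y) = c y) :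
    (constOutputsCircuit X c).IsSymmetric Γ := fun γ =>
  ⟨Equiv.sumCongr (Equiv.refl ↥(Set.range c)) (MulAction.toPerm γ),
    constOutputsCircuit_isAutomorphismExtending hc γ⟩

end Symmetry

end ConstOutputs

/-- **Invariant constant families are symmetrically computable.** For any group `Γ` acting on the
variables `X` and on a finite index set `Y`, and any `Γ`-invariant family of constants
`c : Y → K` (`c (γ • y) = c y`), some `Γ`-symmetric labelled circuit over `K`, `X` with outputs
indexed by `Y` computes the constant polynomial `C (c y)` at the output `y`, on at most `2 |Y|`
gates (Dawar–Wilsenach Defs. 2.2, 3.6, 3.7; the construction is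
`ConstOutputs.constOutputsCircuit`: one constant gate per value of `c` and one unary `+` copy gate
per index, size `|Set.range c| + |Y| ≤ 2 |Y|` by `Fintype.card_sum` and `Fintype.card_range_le`).
[cite: DawarWilsenach2025, Def. 3.7] -/
theorem exists_constOutputs {K : Type u} [CommSemiring K] (X : Type v) {Y : Type z} [Fintype Y]
    {Γ : Type*} [Group Γ] [MulAction Γ X] [MulAction Γ Y] (c : Y → K)
    (hc : ∀ (γ : Γ) (y : Y), c (γ • y) = c y) :
    ∃ (G : Type (max u z)) (_ : Fintype G) (C : LabelledArithCircuit K X Y G),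
      C.IsSymmetric Γ ∧ (∀ y, C.eval (C.output y) = MvPolynomial.C (c y)) ∧
        Fintype.card G ≤ 2 * Fintype.card Y :=
  ⟨↥(Set.range c) ⊕ Y, inferInstance, ConstOutputs.constOutputsCircuit X c,
    ConstOutputs.constOutputsCircuit_isSymmetric hc,
    ConstOutputs.constOutputsCircuit_eval_output, by
      rw [Fintype.card_sum, two_mul]
      exact Nat.add_le_add_right (Fintype.card_range_le c) _⟩

end LabelledArithCircuit

end Literature.Computability.AlgebraicComplexity

end
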